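import Summits.RiemannHypothesis.RiemannHypothesis.Theorems.WeilFormatCEntryArchIntegrals
import HarnessLib

/-!
# GRH arm (rh-explicit, venture WeilGRH): closed forms for the quarter-term integrals `∫ t e^{−lt} sin`, `∫ t² e^{−lt} cos`

Cell `rh-explicit`, WEIL TRACK — GRH ARM (engine seat weil-grh-2 gen9).  Sequel of weil-2's
`WeilFormatCEntryArchIntegrals.lean` (`∫ e^{−lt}cos`, `∫ e^{−lt}sin`, `∫ t e^{−lt}cos` on `[0, T]` with `ωT ∈ 2πℤ`): the two
further elementary integrals that the SECOND Euler step of the `sech` tables (`TwistedSechSeriesQuarter.lean`: extra term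
`((−1)^K/4)∫ t e^{−(K+½)t} F(t) dt` for `F = sin(ω_n t)` and `F = 2 − 2(1 − t/2a)cos(ω_n t)`) evaluates in closed form:

* `hasDerivAt_cexp_mul_sq`, `integral_sq_mul_cexp_mul_zero` — `∫_0^T t² e^{st} dt = (e^{sT}(s²T² − 2sT + 2) − 2)/s³`;
* `sq_div_neg_add_mul_I_cube` — that quotient in Cartesian form for `s = −l + iω`, `e^{sT} = E` real;
* ★ `integral_mul_exp_neg_mul_sin` — `∫_0^T t e^{−lt} sin(ωt) dt = 2lω(1−E)/(l²+ω²)² − TEω/(l²+ω²)`;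
* ★ `integral_sq_mul_exp_neg_mul_cos` — `∫_0^T t² e^{−lt} cos(ωt) dt` as a rational function of `l, ω, T, E`.

No definitions; no named facts; RH/GRH-free.  References: H. Yoshida (1992) §5 [Yoshida1992HermitianForms] (the window
integrals); elementary calculus [folklore].
-/

set_option autoImplicit false

noncomputable section

open Complex MeasureTheory intervalIntegral
open scoped Real

namespace Summit.Ventures.WeilGRH

open Summit.RiemannHypothesis.RiemannHypothesis.Theorems.WeilFormatC

/-- The complex antiderivative of `z² e^{sz}`: `d/dz [e^{sz}(s²z² − 2sz + 2)/s³] = z² e^{sz}` (`s ≠ 0`). [folklore] -/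
theorem hasDerivAt_cexp_mul_sq {s : ℂ} (hs : s ≠ 0) (z : ℂ) :
    HasDerivAt (fun z : ℂ ↦ cexp (s * z) * (s ^ 2 * z ^ 2 - 2 * s * z + 2) / s ^ 3) (z ^ 2 * cexp (s * z)) z := by
  have he : HasDerivAt (fun z : ℂ ↦ cexp (s * z)) (cexp (s * z) * (s * 1)) z :=
    ((hasDerivAt_id z).const_mul s).cexp
  have hq : HasDerivAt (fun z : ℂ ↦ s ^ 2 * z ^ 2 - 2 * s * z + 2) (s ^ 2 * ((2 : ℕ) * z ^ (2 - 1) * 1) - 2 * s * 1) z := by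
    have h1 : HasDerivAt (fun z : ℂ ↦ s ^ 2 * z ^ 2) (s ^ 2 * ((2 : ℕ) * z ^ (2 - 1) * 1)) z :=
      ((hasDerivAt_id z).pow 2).const_mul (s ^ 2)
    have h2 : HasDerivAt (fun z : ℂ ↦ 2 * s * z) (2 * s * 1) z := (hasDerivAt_id z).const_mul (2 * s)
    exact (h1.sub h2).add_const 2
  have h := (he.mul hq).div_const (s ^ 3)
  refine h.congr_deriv ?_
  rw [div_eq_iff (pow_ne_zero 3 hs)]
  push_cast
  ring

/-- `∫_0^T t² e^{st} dt = (e^{sT}(s²T² − 2sT + 2) − 2)/s³` for `s ≠ 0`. [folklore] -/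
theorem integral_sq_mul_cexp_mul_zero (T : ℝ) {s : ℂ} (hs : s ≠ 0) :
    ∫ t in (0 : ℝ)..T, (t : ℂ) ^ 2 * cexp (s * t) = (cexp (s * T) * (s ^ 2 * T ^ 2 - 2 * s * T + 2) - 2) / s ^ 3 := by
  rw [integral_eq_sub_of_hasDerivAt (f := fun x : ℝ ↦ cexp (s * x) * (s ^ 2 * x ^ 2 - 2 * s * x + 2) / s ^ 3)
    (fun t _ ↦ (hasDerivAt_cexp_mul_sq hs (t : ℂ)).comp_ofReal)
    (by apply Continuous.intervalIntegrable; fun_prop)]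
  simp only [Complex.ofReal_zero, mul_zero, Complex.exp_zero, one_mul]
  rw [← sub_div]
  ring

/-- The quotient `(E(s²T² − 2sT + 2) − 2)/s³`, `s = −l + iω`, in Cartesian form (`A = E(T²(l²−ω²) + 2lT + 2) − 2`,
`B = −2EωT(lT + 1)`, `s̄³ = (3lω² − l³) + i(ω³ − 3l²ω)`). [folklore] -/
theorem sq_div_neg_add_mul_I_cube (E T : ℝ) {l ω : ℝ} (hs : l ^ 2 + ω ^ 2 ≠ 0) :
    ((E : ℂ) * ((-(l : ℂ) + ω * I) ^ 2 * T ^ 2 - 2 * (-(l : ℂ) + ω * I) * T + 2) - 2) / (-(l : ℂ) + ω * I) ^ 3 =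
      ((((E * (T ^ 2 * (l ^ 2 - ω ^ 2) + 2 * l * T + 2) - 2) * (3 * l * ω ^ 2 - l ^ 3)
          - (-2 * E * ω * T * (l * T + 1)) * (ω ^ 3 - 3 * l ^ 2 * ω)) / (l ^ 2 + ω ^ 2) ^ 3 : ℝ) : ℂ) +
        ((((E * (T ^ 2 * (l ^ 2 - ω ^ 2) + 2 * l * T + 2) - 2) * (ω ^ 3 - 3 * l ^ 2 * ω)
          + (-2 * E * ω * T * (l * T + 1)) * (3 * l * ω ^ 2 - l ^ 3)) / (l ^ 2 + ω ^ 2) ^ 3 : ℝ) : ℂ) * I := by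
  have hs' := neg_add_mul_I_ne_zero hs
  rw [div_eq_iff (pow_ne_zero 3 hs')]
  apply Complex.ext
  · simp only [Complex.sub_re, Complex.ofReal_re, Complex.mul_re, Complex.add_re, Complex.ofReal_im, Complex.mul_im,
      Complex.I_re, Complex.I_im, Complex.add_im, Complex.neg_re, Complex.neg_im, Complex.sub_im, pow_succ, pow_zero,
      one_mul, Complex.re_ofNat, Complex.im_ofNat]
    field_simp
    ring
  · simp only [Complex.sub_im, Complex.ofReal_im, Complex.mul_im, Complex.add_re, Complex.ofReal_re, Complex.mul_re,
      Complex.I_re, Complex.I_im, Complex.add_im, Complex.neg_re, Complex.neg_im, Complex.sub_re, pow_succ, pow_zero,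
      one_mul, Complex.re_ofNat, Complex.im_ofNat]
    field_simp
    ring

/-- ★ **`∫_0^T t e^{−lt} sin(ωt) dt = 2lω(1 − e^{−lT})/(l² + ω²)² − T e^{−lT} ω/(l² + ω²)`** when `ωT ∈ 2πℤ`,
`l² + ω² ≠ 0`. [folklore] -/
theorem integral_mul_exp_neg_mul_sin {l ω T : ℝ} {m : ℤ} (hωT : ω * T = 2 * π * m) (hs : l ^ 2 + ω ^ 2 ≠ 0) :
    ∫ t in (0 : ℝ)..T, t * Real.exp (-(l * t)) * Real.sin (ω * t) =
      2 * l * ω * (1 - Real.exp (-(l * T))) / (l ^ 2 + ω ^ 2) ^ 2 - T * Real.exp (-(l * T)) * ω / (l ^ 2 + ω ^ 2) := by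
  have hs' := neg_add_mul_I_ne_zero hs
  have hint : IntervalIntegrable (fun t : ℝ ↦ (t : ℂ) * cexp ((-(l : ℂ) + ω * I) * t)) volume 0 T := by
    apply Continuous.intervalIntegrable; fun_prop
  have him : ∀ t : ℝ, t * Real.exp (-(l * t)) * Real.sin (ω * t) =
      ((t : ℂ) * cexp ((-(l : ℂ) + ω * I) * t)).im := by
    intro t
    rw [cexp_neg_add_mul_I_mul]
    simp only [Complex.mul_re, Complex.add_re, Complex.ofReal_re, Complex.ofReal_im, Complex.mul_im,
      Complex.I_re, Complex.I_im, Complex.add_im]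
    ring
  simp_rw [him]
  rw [show (∫ t in (0 : ℝ)..T, ((t : ℂ) * cexp ((-(l : ℂ) + ω * I) * t)).im) =
      Complex.imCLM (∫ t in (0 : ℝ)..T, (t : ℂ) * cexp ((-(l : ℂ) + ω * I) * t)) by
    rw [← Complex.imCLM.intervalIntegral_comp_comm hint]; rfl,
    integral_mul_cexp_mul_zero T hs', cexp_neg_add_mul_I_of_period hωT, lin_div_neg_add_mul_I_sq _ _ hs]
  simp only [Complex.imCLM_apply, Complex.add_im, Complex.ofReal_im, Complex.mul_im, Complex.I_re, Complex.I_im,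
    Complex.ofReal_re, mul_zero, zero_add, mul_one, add_zero]

/-- ★ **`∫_0^T t² e^{−lt} cos(ωt) dt`** in closed form when `ωT ∈ 2πℤ`, `l² + ω² ≠ 0` (`E = e^{−lT}`):
`[(E(T²(l²−ω²) + 2lT + 2) − 2)(3lω² − l³) + 2EωT(lT+1)(ω³ − 3l²ω)]/(l²+ω²)³`. [folklore] -/
theorem integral_sq_mul_exp_neg_mul_cos {l ω T : ℝ} {m : ℤ} (hωT : ω * T = 2 * π * m) (hs : l ^ 2 + ω ^ 2 ≠ 0) :
    ∫ t in (0 : ℝ)..T, t ^ 2 * Real.exp (-(l * t)) * Real.cos (ω * t) =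
      ((Real.exp (-(l * T)) * (T ^ 2 * (l ^ 2 - ω ^ 2) + 2 * l * T + 2) - 2) * (3 * l * ω ^ 2 - l ^ 3)
          - (-2 * Real.exp (-(l * T)) * ω * T * (l * T + 1)) * (ω ^ 3 - 3 * l ^ 2 * ω)) / (l ^ 2 + ω ^ 2) ^ 3 := by
  have hs' := neg_add_mul_I_ne_zero hs
  have hint : IntervalIntegrable (fun t : ℝ ↦ (t : ℂ) ^ 2 * cexp ((-(l : ℂ) + ω * I) * t)) volume 0 T := by
    apply Continuous.intervalIntegrable; fun_prop
  have hre : ∀ t : ℝ, t ^ 2 * Real.exp (-(l * t)) * Real.cos (ω * t) =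
      ((t : ℂ) ^ 2 * cexp ((-(l : ℂ) + ω * I) * t)).re := by
    intro t
    rw [cexp_neg_add_mul_I_mul]
    simp only [Complex.mul_re, Complex.add_re, Complex.ofReal_re, Complex.ofReal_im, Complex.mul_im,
      Complex.I_re, Complex.I_im, Complex.add_im, pow_succ, pow_zero, one_mul]
    ring
  simp_rw [hre]
  rw [show (∫ t in (0 : ℝ)..T, ((t : ℂ) ^ 2 * cexp ((-(l : ℂ) + ω * I) * t)).re) =
      Complex.reCLM (∫ t in (0 : ℝ)..T, (t : ℂ) ^ 2 * cexp ((-(l : ℂ) + ω * I) * t)) by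
    rw [← Complex.reCLM.intervalIntegral_comp_comm hint]; rfl,
    integral_sq_mul_cexp_mul_zero T hs', cexp_neg_add_mul_I_of_period hωT, sq_div_neg_add_mul_I_cube _ _ hs]
  simp only [Complex.reCLM_apply, Complex.add_re, Complex.ofReal_re, Complex.mul_re, Complex.I_re, Complex.I_im,
    Complex.ofReal_im, mul_zero, sub_zero, add_zero, mul_one]

end Summit.Ventures.WeilGRH

end
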